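import Literature.InformationTheory.QuantumCodes.SubsystemCodeDistanceBound
import Literature.InformationTheory.QuantumCodes.LocalCodeEnergyBarrier
import HarnessLib

/-!
# Bravyi–Terhal 2009, Theorem 2*: no energy barrier for 2D stabilizer Hamiltonians even with gauge qubits — proof

S. Bravyi, B. Terhal, arXiv:0810.1983 [BravyiTerhal2009], §1.2 (chunk p0006 L46–63): «Theorem 2 can be strengthened
for stabilizer codes which encode more than one logical qubit. Specifically, we can encode `k` qubits using a
stabilizer code with `g+k` logical qubits by regarding the extra `g` logical qubits as “gauge qubits” … any error
affecting only the gauge qubits can be ignored. In this case the energy barrier that the environment has to overcome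
in order to implement a non-trivial logical operator would be `d‡(𝒢) = min_{E ∈ 𝒞(𝒮)∖𝒢} min_{γ ∈ 𝒲(I,E)} ε_max(γ)`,
where `𝒢 = ⟨𝒮, X̄_1, Z̄_1, …, X̄_g, Z̄_g⟩` … Theorem 2*. Under the assumptions of Theorem 2 the energy barrier `d‡(𝒢)`
is upper bounded by a constant independent of the lattice size `L` for any choice of the gauge Pauli operators
`X̄_1, Z̄_1, …, X̄_g, Z̄_g`.» Proof (§3.3, p0014 L20–27): «Theorems 1* and 2* are direct corollaries of Proposition 2.
Indeed, choose any logical operator `P ∈ 𝒞(𝒮)∖𝒢` with a linear dimension `d_1(P) ≤ r` … if `D = 2` then the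
bound `d_1(P) ≤ r` implies that the support of `P` can be covered by a quasi-1D vertical string and thus one can
construct a walk `γ ∈ 𝒲(I,P)` with `ε_max(γ) = O(1)`. It proves Theorem 2*.»

THIS FILE PROVES Theorem 2* (open boundary conditions, explicit constant `2r²g_max`, in the generality of
Proposition 2: any gauge space `Ḡ` whose stabilizer space is the Hamiltonian's stabilizer space `⟨g_a⟩`):
`BravyiTerhal2009_theorem2_star` — there is a DRESSED logical operator `E ∈ S̄⊥ ∖ Ḡ` (non-trivial on the protected
qubits, not merely on the gauge qubits) and a walk `0 = P_0, …, P_{L²} = E` on the Pauli group with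
`ε(P_i) ≤ 2 r² g_max` for every `i`. Ingredients: the strip dressed logical operator of Prop. 2 (the core
`sympDual_gauge_le_of_slabs` of `SubsystemCodeDistanceBound.lean`, read contrapositively:
`exists_dressed_in_slab`) and the row-by-row walk with its front estimate from `LocalCodeEnergyBarrier.lean`
(`EnergyBarrier.rowWalk`, `energyCost_prefixWalk_le`), unchanged since `E` commutes with every `g_a`.

Deliberately NOT here: periodic boundary conditions; general subsystem Hamiltonians `H = −Σ G_a` with
non-commuting gauge generators (§3.2's `ε(E) ≤ 2#{a : E G_a = −G_a E}` is only an upper bound there).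

## Mathlib / tree search

Tree: `energyCost`, `IsPauliWalk`, `EnergyBarrier.{rowWalk, rowWalk_zero, rowWalk_last, isPauliWalk_rowWalk,
energyCost_prefixWalk_le}` (LocalCodeEnergyBarrier.lean); `sympDual_gauge_le_of_slabs` (SubsystemCodeDistanceBound.lean);
`gaugeStabilizer`, `IsSubsystemCode`, `gaugeStabilizer_le` (SubsystemCodes.lean); `colSlab`, `slab`,
`slabPair_of_isCubeLocal` (LocalCodeDistanceBound.lean).
-/

namespace Literature.InformationTheory.QuantumCodes

open Finset Module
open Classical

variable {n : ℕ}

namespace EnergyBarrier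

variable {L : ℕ} {ι : Type*} {g : ι → SympVec n} {G : Submodule (ZMod 2) (SympVec n)}

/-- **A vertical strip of width `≤ r` supports a dressed logical operator** (Prop. 2, `d_1(𝒢) ≤ r`, open boundary
conditions; contrapositive of `sympDual_gauge_le_of_slabs` for `k ≥ 1`): with `w = max(r−1,1)`, some slab
`{⌊x/w⌋ = j}` supports an element of `S̄⊥ ∖ Ḡ`. [cite: BravyiTerhal2009, §3.3 Prop. 2 (p. 13: «d_1(𝒢) ≤ r») and «choose any logical operator P ∈ 𝒞(𝒮)∖𝒢 with a linear dimension d_1(P) ≤ r» (p. 14)] -/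
theorem exists_dressed_in_slab {D' k d r : ℕ} (e : Fin n ≃ (Fin (D' + 1) → Fin L)) (hr : 1 ≤ r)
    (hS : gaugeStabilizer G = Submodule.span (ZMod 2) (Set.range g)) (hg : ∀ a, IsCubeLocal e r (g a))
    (hcode : IsSubsystemCode G k d) (hk : 1 ≤ k) :
    ∃ j : ℕ, ∃ Q ∈ sympDual (gaugeStabilizer G), Q ∉ G ∧
      Q ∈ supportedOn (slab (colSlab e 0 (max (r - 1) 1)) j) := by
  set w : ℕ := max (r - 1) 1 with hwdef
  have hw1 : 1 ≤ w := le_max_right _ _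
  have hrw : r ≤ w + 1 := by have := le_max_left (r - 1) 1; omega
  have hsep : ∀ a, ∃ j₀ : ℕ, ∀ q ∈ sympSupport (g a),
      colSlab e 0 w q = j₀ ∨ colSlab e 0 w q = j₀ + 1 :=
    fun a => slabPair_of_isCubeLocal 0 hw1 hrw (hg a)
  by_contra hnone
  push Not at hnone
  have h0 : ∀ j, ∀ Q ∈ sympDual (gaugeStabilizer G), Q ∈ supportedOn (slab (colSlab e 0 w) j) → Q ∈ G := by
    intro j Q hQd hQs
    by_contra hQG
    exact hnone j Q hQd hQG hQs
  have hle : sympDual G ≤ G := sympDual_gauge_le_of_slabs (colSlab e 0 w) g hS hsep h0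
  have hSe : gaugeStabilizer G = sympDual G := inf_eq_right.2 hle
  have hdim := hcode.1
  rw [hSe] at hdim
  have := hr
  omega

end EnergyBarrier

open EnergyBarrier in
/-- **Bravyi–Terhal 2009, Theorem 2* — proved (open boundary conditions, explicit constant).** «Under the
assumptions of Theorem 2 the energy barrier `d‡(𝒢)` is upper bounded by a constant independent of the lattice size
`L` for any choice of the gauge Pauli operators `X̄_1, Z̄_1, …, X̄_g, Z̄_g`», `d‡(𝒢) = min_{E ∈ 𝒞(𝒮)∖𝒢} min_γ ε_max(γ)`.
Typed, in the generality of Prop. 2: for the stabilizer Hamiltonian `H = −Σ_a g_a` on the `L × L` square lattice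
(placement `e`), every generator covered by an `r × r` square (`r ≥ 1`), every qubit in the support of at most `g_max`
generators, and ANY gauge space `Ḡ` whose stabilizer space `Ḡ ⊓ Ḡ⊥` is `⟨g_a⟩`, with `k ≥ 1` protected qubits: there
is a DRESSED logical operator `E ∈ S̄⊥ ∖ Ḡ` and a walk `0 = P_0, …, P_m = E` on the Pauli group (consecutive classes
differ on at most one qubit) with `ε(P_i) = 2 #{a : ⟨g_a, P_i⟩ = 1} ≤ 2 r² g_max` for every `i`; so
`d‡(𝒢) ≤ 2 r² g_max`. Column: proved theorem. -- TODO(general form): periodic boundary conditions.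
[cite: BravyiTerhal2009, §1.2 Thm. 2* (p. 6) with the proof on p. 14 (Prop. 2 + «a walk γ ∈ 𝒲(I,P) with ε_max(γ) = O(1)»)] -/
theorem BravyiTerhal2009_theorem2_star {L n k d : ℕ} (r gmax : ℕ) (e : Fin n ≃ (Fin 2 → Fin L)) {ι : Type*}
    [Fintype ι] (g : ι → SympVec n) (G : Submodule (ZMod 2) (SympVec n)) (hr : 1 ≤ r)
    (hS : gaugeStabilizer G = Submodule.span (ZMod 2) (Set.range g)) (hg : ∀ a, IsCubeLocal e r (g a))
    (hdeg : ∀ q : Fin n, #(univ.filter fun a => q ∈ sympSupport (g a)) ≤ gmax) (hcode : IsSubsystemCode G k d)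
    (hk : 1 ≤ k) :
    ∃ E ∈ sympDual (gaugeStabilizer G), E ∉ G ∧ ∃ (m : ℕ) (γ : Fin (m + 1) → SympVec n),
      γ 0 = 0 ∧ γ (Fin.last m) = E ∧ IsPauliWalk γ ∧ ∀ i, energyCost g (γ i) ≤ 2 * r ^ 2 * gmax := by
  have hn : n = L ^ 2 := by simpa using Fintype.card_congr e
  have hL : 0 < L := by
    rcases Nat.eq_zero_or_pos L with h | h
    · exfalso
      rw [h] at hn
      simp at hn
      -- n = 0: no room for a logical qubit
      subst hn
      have h1 := hcode.1
      have h2 := finrank_sympDual_add G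
      omega
    · exact h
  obtain ⟨j, Q, hQd, hQG, hQs⟩ := exists_dressed_in_slab (D' := 1) e hr hS hg hcode hk
  have hE : ∀ a, sympInner (g a) Q = 0 := fun a =>
    (mem_sympDual_iff.1 hQd) (g a) (by rw [hS]; exact Submodule.subset_span ⟨a, rfl⟩)
  refine ⟨Q, hQd, hQG, L * L, rowWalk e Q, rowWalk_zero Q, rowWalk_last Q, isPauliWalk_rowWalk hL Q, fun i => ?_⟩
  have hw1 : 1 ≤ max (r - 1) 1 := le_max_right _ _
  have hwr : max (r - 1) 1 ≤ r := max_le (Nat.sub_le r 1) hr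
  exact energyCost_prefixWalk_le hL hwr hw1 hg hdeg hE hQs i

/-- **Theorem 2* ⇒ Theorem 2** (sanity / the case `g = 0`): for the stabilizer code itself (`Ḡ = S̄ = ⟨g_a⟩`) the
dressed logical operator of Theorem 2* is an ordinary logical operator `E ∈ S̄⊥ ∖ S̄`.
[cite: BravyiTerhal2009, §1.2 Thms. 2 and 2* (p. 6)] -/
theorem BravyiTerhal2009_theorem2_of_star {L n k d : ℕ} (r gmax : ℕ) (e : Fin n ≃ (Fin 2 → Fin L)) {ι : Type*}
    [Fintype ι] (g : ι → SympVec n) {S : Submodule (ZMod 2) (SympVec n)} (hr : 1 ≤ r)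
    (hS : S = Submodule.span (ZMod 2) (Set.range g)) (hg : ∀ a, IsCubeLocal e r (g a))
    (hdeg : ∀ q : Fin n, #(univ.filter fun a => q ∈ sympSupport (g a)) ≤ gmax) (hcode : IsAdditiveCode S k d)
    (hk : 1 ≤ k) :
    ∃ E ∈ sympDual S, E ∉ S ∧ ∃ (m : ℕ) (γ : Fin (m + 1) → SympVec n),
      γ 0 = 0 ∧ γ (Fin.last m) = E ∧ IsPauliWalk γ ∧ ∀ i, energyCost g (γ i) ≤ 2 * r ^ 2 * gmax := by
  have hSS : gaugeStabilizer S = S := gaugeStabilizer_eq_self_of_isSelfOrthogonal hcode.1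
  have h := BravyiTerhal2009_theorem2_star r gmax e g S hr (hSS.trans hS) hg hdeg hcode.isSubsystemCode hk
  rwa [hSS] at h

end Literature.InformationTheory.QuantumCodes
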